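/-
Copyright (c) 2026 the pub-hodgecm-mathlib formalisation cell (harness21).  Prover seat hodgecm-mathlib-K2E1-p08 (g5), Track B ∕ K2-LIT, h413 =
`stmt-HodgeConjecture-24833`, campaign «EIS-RANK-ONE» [D5] `K2E1KFiniteArchSmoothU2`, Fréchet road, file (D5-a2): the EXPLICIT HEIGHT along the big-cell line of `U(1,1)`
(dealer K2E1-plan (g4) 2026-09-04T06:23:41Z, my cut 06:24:54Z).
-/
import Summits.HodgeConjecture.HodgeConjecture.Theorems.K2E1BorelHeightWeylUnipotent        -- ★ (K2E1-p08 g4): `(ι(J_N))_{N,1} = 1`, currency `borelHeight`, `weylLongU`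
import Literature.NumberTheory.Automorphic.UnitaryGroupLineKAverageArchSmoothTwo            -- ★ `coe_adelicVal_middleRootUnipotent_two` (`π(n b) = 1 + bE₀₁`)
import Literature.NumberTheory.Automorphic.UnitaryGroupCuspIntegralSiegelMajorant           -- ★ `borelHeight_mul_of_mem_comap_standardMaximalCompactGL` (`H(gk) = H(g)`)
import Literature.NumberTheory.Automorphic.AdelicHeightAffineLineAdele                      -- ★ `vecArchNorm_vecCons_one_adele`, `vecFinHeight_vecCons_one_adele`
import Literature.NumberTheory.Automorphic.AdeleGaloisDescent                               -- ★ `norm_infiniteCompletionOfComap`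
import HarnessLib

/-!
# K2·E1 — `K2E1HeightBigCellLineFormulaU2` ([D5] file (D5-a2)): THE HEIGHT ALONG THE BIG-CELL LINE OF `U(1,1)` IS EXPLICIT —
# `H(ι(w₀)·n(θ t)·k) = h(1, θ t)⁻¹ = (∏_{w∣∞} (1 + |θ t|_w²) · ∏ᶠ_v max(1, |θ t|_v))⁻¹`, and `|θ(s, b)|_w² = (w δ)²·s_{w|L⁺}²` on `L⁺ ⊗ ℝ`

Track B ∕ K2-LIT, crux h413 = `stmt-HodgeConjecture-24833`, route of record `HCCMUnconditional`; cell `hodgecm-mathlib`, squad K2, ENGINE E1, campaign EIS-RANK-ONE, deal [D5]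
(the archimedean smoothness binder `hφarch` of ★ `K2E1EisensteinMinusConstantTermBoundedArchCMTwo.exists_bound_sub_borelConstantTerm_cm_two_of_archSmooth` for the spherical
flat section).  Prover seat `hodgecm-mathlib-K2E1-p08` (g5).  THEOREMS ONLY (no `def`, no `instance`, no notation, no named-fact hypothesis, no `sorry`); lane `--kind proof
--supports stmt-HodgeConjecture-24833 --as helper` (count-neutral, closes no socket).

WHY.  The flat section is `f_z = φ·H^z` (★ `flatSectionU`), and `hφarch` asks for the Fréchet derivatives of `s ↦ f_z(ι(w₀)·n(θ(ι⁻¹ s, b))·k)` on `mixedSpace L⁺`.  For the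
spherical `φ ≡ φ₀` everything is the function `s ↦ H(ι(w₀)·n(θ(ι⁻¹ s, b))·k)^z`, and this file computes that height IN CLOSED FORM:
* §1 (any quadratic pair, `N = 2`) `lastRow_weylLongU_mul_middleRootUnipotent_two`: the last row of `ι(J₂)·n(b) = J₂(1 + bE₀₁)` is `(1, b)`; hence
  **`borelHeight_weylLongU_mul_middleRootUnipotent_mul_two`**: `H(ι(w₀)·n(b)·k) = h(1, b)⁻¹` for `k ∈ K_U` (★ `borelHeight_mul_of_mem_comap_standardMaximalCompactGL`).
* §2 `vecHeight_vecCons_one_adele_eq` : `h(1, η) = ∏_w √(1+|η_w|²)^{mult w} · ∏ᶠ_v max(1,|η_v|_v)` (★ `AdelicHeightAffineLineAdele`), and over a totally complex field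
  **`vecHeight_vecCons_one_adele_eq_of_isTotallyComplex`**: `h(1, η) = ∏_w (1 + |η_w|²) · ∏ᶠ_v max(1, |η_v|_v)` (`mult w = 2`).
* §3 the trace-zero line `θ t = t ⊗ δ` (★ `coe_traceZeroLine`): `|θ t|_w = |t_{w|F}|·(w δ)` (`norm_fst_coe_traceZeroLine`), the finite part of `θ(a, b)` does not see `a`
  (`snd_coe_traceZeroLine_mk`, `rfl`), and `|(ι a)_v| = |a_v|` at a real place (`abs_ringEquiv_mixedSpace_fst`, Mathlib's isometry `extensionEmbeddingOfIsReal`).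
* §4 (CM field `L`, `F = L⁺` totally real, every `w ∣ ∞` of `L` complex) the assembled formula **`coe_borelHeight_weylLongU_line_mul_eq_cm_two`**: for `k ∈ K_U`, `b ∈ 𝔸_{L⁺}^∞`,
  `s ∈ mixedSpace L⁺`, `H(ι(w₀)·n(θ(ι⁻¹ s, b))·k) = ((∏_{w} (1 + (w δ)²·(s_{w|L⁺})²)) · h_f(b))⁻¹` with `h_f(b) = ∏ᶠ_v max(1, |θ(0,b)_v|_v) ≥ 1` — a product of the
  one-variable symbols `(1 + c_w s_w²)` of ★ (D5-a1) `K2E1OnePlusSqPowerSymbol` (`c_w = (w δ)² > 0`), ready for the tensor Leibniz rule ★ (D5-a3 core) `K2E1TensorSymbolProduct`.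
[MoeglinWaldspurger1995, I.2.2 (heights on the big cell), II.1.5; Garrett2018, §2.2 (`h(1, x)`); Rogawski1990, §1.10.]

HONEST LABEL: HC_CM is proved only modulo the 7 printed citations (2 remaining named inputs: hLiu418 = `stmt-HodgeConjecture-24832`, h413 = `stmt-HodgeConjecture-24833`) until
rung 0 closes; count-neutral helper, closes no socket.

## References
* [MoeglinWaldspurger1995] C. Mœglin, J.-L. Waldspurger, *Spectral Decomposition and Eisenstein Series* (1995), I.2.2, II.1.5.
* [Garrett2018] P. Garrett, *Modern Analysis of Automorphic Forms by Example* (2018), §2.2.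
* [Rogawski1990] J. D. Rogawski, *Automorphic Representations of Unitary Groups in Three Variables* (1990), §1.10.
-/

set_option autoImplicit false
-- the mandated namespace repeats the single-problem summit's segment (`HodgeConjecture.HodgeConjecture`)
set_option linter.dupNamespace false

noncomputable section

open NumberField NumberField.InfinitePlace NumberField.mixedEmbedding IsDedekindDomain Matrix
open Literature.NumberTheory.Automorphic Literature.NumberTheory.Automorphic.UnitaryGroup AdelicGroupData
open Summit.HodgeConjecture.HodgeConjecture.Cruxes.H413.K2E1BorelHeightWeylUnipotent
-- `Classical` is needed to see the Mathlib normed-space instances on `mixedSpace` (note H5 of `AdelicGLnGlue`)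
open scoped NNReal MatrixGroups Classical

namespace Summit.HodgeConjecture.HodgeConjecture.Cruxes.H413.K2E1HeightBigCellLineFormulaU2

/-! ## §1 The last row of `ι(J₂)·n(b)` and the height `H(ι(w₀)·n(b)·k) = h(1, b)⁻¹` -/

section BigCell

variable {F E : Type} [Field F] [NumberField F] [Field E] [NumberField E] [Algebra F E] {c : E ≃ₐ[F] E}
  (hij : (((0 : Fin 2) : ℕ)) + 1 = ((1 : Fin 2) : ℕ)) (hN : 2 = 2 * ((0 : Fin 2) : ℕ) + 2)

/-- `(J₂)_{2,2} = 0` adelically: the bottom-right entry of `ι(J₂) = ι(w₀)` vanishes. [cite: MoeglinWaldspurger1995, I.2.2] -/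
theorem adelicVal_weylLongU_apply_top_one_two :
    (adelicVal F E c 2 _ ((quasiSplit F E c 2).toAdelic (weylLongU (c : E →+* E) (rfl : (StdForm.antidiagonal 2).over E = (StdForm.antidiagonal 2).over E))) :
      Matrix (Fin 2) (Fin 2) (AdeleRing (𝓞 E) E)) ⊤ 1 = 0 := by
  change algebraMap E (AdeleRing (𝓞 E) E)
      ((((weylLongU (c : E →+* E) (rfl : (StdForm.antidiagonal 2).over E = (StdForm.antidiagonal 2).over E) :
        ↥(unitaryGroupOfForm (c : E →+* E) ((StdForm.antidiagonal 2).over E))) : GL (Fin 2) E) : Matrix (Fin 2) (Fin 2) E) ⊤ 1) = 0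
  rw [coe_coe_weylLongU, StdForm.antidiagonal_over_apply, if_neg (by decide), map_zero]

/-- **THE LAST ROW OF `ι(J₂)·n(b)` IS `(1, b)`**: `e₂·J₂·(1 + bE₀₁) = e₁·(1 + bE₀₁) = (1, b)` (★ `coe_adelicVal_middleRootUnipotent_two`, ★ `adelicVal_weylLongU_apply_top_zero`).
[cite: MoeglinWaldspurger1995, I.2.2] [cite: Rogawski1990, §1.10] -/
theorem lastRow_weylLongU_mul_middleRootUnipotent_two (b : traceZeroAdele F E c) :
    lastRow ((quasiSplit F E c 2).toAdelic (weylLongU (c : E →+* E) (rfl : (StdForm.antidiagonal 2).over E = (StdForm.antidiagonal 2).over E)) *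
      ((middleRootUnipotent hij hN (Multiplicative.ofAdd b) : adelicUnipotent F E c 2) : (quasiSplit F E c 2).Adelic)) =
      ![1, (b : AdeleRing (𝓞 E) E)] := by
  funext j
  rw [lastRow_apply, map_mul, Units.val_mul, Matrix.mul_apply, Fin.sum_univ_two, adelicVal_weylLongU_apply_top_zero, one_mul,
    coe_adelicVal_middleRootUnipotent_two, adelicVal_weylLongU_apply_top_one_two, zero_mul, add_zero, Matrix.add_apply, Matrix.one_apply,
    Matrix.single_apply]
  fin_cases j
  · simp
  · simp

/-- **`H(ι(w₀)·n(b)) = h(1, b)⁻¹`** on `U(J₂)(𝔸_F)`. [cite: MoeglinWaldspurger1995, I.2.2] [cite: Garrett2018, §2.2] -/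
theorem borelHeight_weylLongU_mul_middleRootUnipotent_two (b : traceZeroAdele F E c) :
    borelHeight ((quasiSplit F E c 2).toAdelic (weylLongU (c : E →+* E) (rfl : (StdForm.antidiagonal 2).over E = (StdForm.antidiagonal 2).over E)) *
      ((middleRootUnipotent hij hN (Multiplicative.ofAdd b) : adelicUnipotent F E c 2) : (quasiSplit F E c 2).Adelic)) =
      (vecHeight E (![1, (b : AdeleRing (𝓞 E) E)] : Fin 2 → AdeleRing (𝓞 E) E))⁻¹ := by
  rw [borelHeight_def, lastRow_weylLongU_mul_middleRootUnipotent_two]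

/-- **`H(ι(w₀)·n(b)·k) = h(1, b)⁻¹` FOR `k ∈ K_U`** (`H` is right-`K_U`-invariant, ★ `borelHeight_mul_of_mem_comap_standardMaximalCompactGL`).
[cite: MoeglinWaldspurger1995, I.2.2] [cite: Garrett2018, §2.2] -/
theorem borelHeight_weylLongU_mul_middleRootUnipotent_mul_two (b : traceZeroAdele F E c) {k : (quasiSplit F E c 2).Adelic}
    (hk : k ∈ ((standardMaximalCompactGL 2 E).comap (adelicVal F E c 2 ((StdForm.antidiagonal 2).over E)) : Subgroup (quasiSplit F E c 2).Adelic)) :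
    borelHeight ((quasiSplit F E c 2).toAdelic (weylLongU (c : E →+* E) (rfl : (StdForm.antidiagonal 2).over E = (StdForm.antidiagonal 2).over E)) *
      ((middleRootUnipotent hij hN (Multiplicative.ofAdd b) : adelicUnipotent F E c 2) : (quasiSplit F E c 2).Adelic) * k) =
      (vecHeight E (![1, (b : AdeleRing (𝓞 E) E)] : Fin 2 → AdeleRing (𝓞 E) E))⁻¹ := by
  rw [borelHeight_mul_of_mem_comap_standardMaximalCompactGL hk, borelHeight_weylLongU_mul_middleRootUnipotent_two]

end BigCell

/-! ## §2 The height of `(1, η)` in closed form -/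

section AffineLine

variable (K : Type) [Field K] [NumberField K]

/-- **`h(1, η) = ∏_{w∣∞} √(1 + |η_w|²)^{mult w} · ∏ᶠ_v max(1, |η_v|_v)`** (★ `vecArchNorm_vecCons_one_adele`, ★ `vecFinHeight_vecCons_one_adele`). [cite: Garrett2018, §2.2] -/
theorem vecHeight_vecCons_one_adele_eq (η : AdeleRing (𝓞 K) K) :
    vecHeight K (![1, η] : Fin 2 → AdeleRing (𝓞 K) K) =
      (∏ w : InfinitePlace K, NNReal.sqrt (1 + ‖η.1 w‖₊ ^ 2) ^ w.mult) * ∏ᶠ v : HeightOneSpectrum (𝓞 K), max 1 ‖η.2 v‖₊ := by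
  rw [vecHeight]
  congr 1
  · exact Finset.prod_congr rfl fun w _ => by rw [vecArchNorm_vecCons_one_adele]
  · exact finprod_congr fun v => vecFinHeight_vecCons_one_adele K η v

/-- **Over a TOTALLY COMPLEX field `h(1, η) = ∏_{w∣∞} (1 + |η_w|²) · ∏ᶠ_v max(1, |η_v|_v)`** (every `mult w = 2`). [cite: Garrett2018, §2.2] -/
theorem vecHeight_vecCons_one_adele_eq_of_isTotallyComplex [IsTotallyComplex K] (η : AdeleRing (𝓞 K) K) :
    vecHeight K (![1, η] : Fin 2 → AdeleRing (𝓞 K) K) =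
      (∏ w : InfinitePlace K, (1 + ‖η.1 w‖₊ ^ 2)) * ∏ᶠ v : HeightOneSpectrum (𝓞 K), max 1 ‖η.2 v‖₊ := by
  rw [vecHeight_vecCons_one_adele_eq]
  congr 1
  refine Finset.prod_congr rfl fun w _ => ?_
  rw [mult_isComplex ⟨w, IsTotallyComplex.isComplex w⟩, NNReal.sq_sqrt]

/-- `1 ≤ ∏ᶠ_v max(1, |η_v|_v)`: the finite part of `h(1, η)` is at least one. [cite: Garrett2018, §2.2] -/
theorem one_le_finprod_max_one_nnnorm_snd (η : AdeleRing (𝓞 K) K) :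
    (1 : ℝ≥0) ≤ ∏ᶠ v : HeightOneSpectrum (𝓞 K), max 1 ‖η.2 v‖₊ :=
  one_le_finprod' fun _ => le_max_left _ _

/-- `1 ≤ ∏_{w∣∞} (1 + |η_w|²)`: the archimedean part is at least one. [cite: Garrett2018, §2.2] -/
theorem one_le_prod_one_add_nnnorm_sq (η : AdeleRing (𝓞 K) K) :
    (1 : ℝ≥0) ≤ ∏ w : InfinitePlace K, (1 + ‖η.1 w‖₊ ^ 2) :=
  Finset.one_le_prod' fun _ _ => le_self_add

end AffineLine

/-! ## §3 The trace-zero line `θ t = t ⊗ δ`: archimedean coordinates, finite part, the mixed-space chart -/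

section Line

variable {F E : Type} [Field F] [NumberField F] [Field E] [NumberField E] [Algebra F E] [Algebra.IsQuadraticExtension F E] {c : E ≃ₐ[F] E}
  {δ : E} (hcδ : c δ = -δ) (hδ : δ ≠ 0)

/-- `|δ|_w = w δ`: the norm of the principal adele `δ` at an infinite place. [folklore] -/
theorem norm_fst_algebraMap_adele (a : E) (w : InfinitePlace E) : ‖(algebraMap E (AdeleRing (𝓞 E) E) a).1 w‖ = w a := by
  rw [show (algebraMap E (AdeleRing (𝓞 E) E) a).1 w = (a : w.Completion) from rfl, InfinitePlace.Completion.norm_coe]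
  rfl

/-- **`|θ t|_w = |t_{w|F}| · (w δ)`**: the archimedean coordinates of the trace-zero line `θ t = t ⊗ δ` (★ `coe_traceZeroLine`, isometry ★ `norm_infiniteCompletionOfComap`).
[cite: CasselsFrohlichANT1967, Ch. II §14] -/
theorem norm_fst_coe_traceZeroLine (t : AdeleRing (𝓞 F) F) (w : InfinitePlace E) :
    ‖((traceZeroLine F E c hcδ hδ t : traceZeroAdele F E c) : AdeleRing (𝓞 E) E).1 w‖ = ‖t.1 (w.comap (algebraMap F E))‖ * w δ := by
  rw [coe_traceZeroLine]
  change ‖(AdeleRing.baseChange F E t).1 w * (algebraMap E (AdeleRing (𝓞 E) E) δ).1 w‖ = _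
  rw [norm_mul, AdeleRing.baseChange_fst, InfiniteAdeleRing.baseChange_apply, norm_infiniteCompletionOfComap, norm_fst_algebraMap_adele]

/-- The `nnnorm` form: `‖θ t‖₊_w = ‖t_{w|F}‖₊ · ‖δ‖₊_w` with `(‖δ‖₊_w : ℝ) = w δ`. [cite: CasselsFrohlichANT1967, Ch. II §14] -/
theorem coe_nnnorm_fst_coe_traceZeroLine (t : AdeleRing (𝓞 F) F) (w : InfinitePlace E) :
    ((‖((traceZeroLine F E c hcδ hδ t : traceZeroAdele F E c) : AdeleRing (𝓞 E) E).1 w‖₊ : ℝ≥0) : ℝ) = ‖t.1 (w.comap (algebraMap F E))‖ * w δ := by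
  rw [coe_nnnorm, norm_fst_coe_traceZeroLine]

omit [NumberField F] [NumberField E] in
/-- **The finite part of `θ(a, b)` does not see `a`** (definitional: `θ(a,b)^∞ = b ⊗ δ`). [cite: CasselsFrohlichANT1967, Ch. II §14] -/
theorem snd_coe_traceZeroLine_mk [NumberField F] [NumberField E] (a a' : InfiniteAdeleRing F) (b : FiniteAdeleRing (𝓞 F) F) :
    ((traceZeroLine F E c hcδ hδ ((a, b) : AdeleRing (𝓞 F) F) : traceZeroAdele F E c) : AdeleRing (𝓞 E) E).2 =
      ((traceZeroLine F E c hcδ hδ ((a', b) : AdeleRing (𝓞 F) F) : traceZeroAdele F E c) : AdeleRing (𝓞 E) E).2 := rfl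

omit [NumberField F] [Algebra.IsQuadraticExtension F E] in
/-- **`|(ι a)_v| = |a_v|` at a real place `v`**: the real coordinate of Mathlib's `ringEquiv_mixedSpace` is the isometry `extensionEmbeddingOfIsReal`. [folklore] -/
theorem abs_ringEquiv_mixedSpace_fst (a : InfiniteAdeleRing F) (v : InfinitePlace F) (hv : v.IsReal) :
    |(InfiniteAdeleRing.ringEquiv_mixedSpace F a).1 ⟨v, hv⟩| = ‖a v‖ := by
  rw [InfiniteAdeleRing.ringEquiv_mixedSpace_apply]
  dsimp only
  rw [← Real.norm_eq_abs]
  exact (Completion.isometry_extensionEmbeddingOfIsReal hv).norm_map_of_map_zero (map_zero _) _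

omit [NumberField F] [Algebra.IsQuadraticExtension F E] in
/-- **`|(ι⁻¹ s)_v| = |s_v|` at a real place `v`** (the inverse chart). [folklore] -/
theorem norm_ringEquiv_mixedSpace_symm_apply (s : mixedSpace F) (v : InfinitePlace F) (hv : v.IsReal) :
    ‖(InfiniteAdeleRing.ringEquiv_mixedSpace F).symm s v‖ = |s.1 ⟨v, hv⟩| := by
  conv_rhs => rw [← (InfiniteAdeleRing.ringEquiv_mixedSpace F).apply_symm_apply s]
  rw [abs_ringEquiv_mixedSpace_fst]

/-- **`|θ(ι⁻¹ s, b)|_w² = (w δ)² · s_{w|F}²`** along the mixed-space chart, at a place `w ∣ ∞` of `E` over a REAL place of `F`. [cite: CasselsFrohlichANT1967, Ch. II §14] -/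
theorem coe_nnnorm_fst_coe_traceZeroLine_symm_sq (s : mixedSpace F) (b : FiniteAdeleRing (𝓞 F) F) (w : InfinitePlace E) (hw : (w.comap (algebraMap F E)).IsReal) :
    (((‖((traceZeroLine F E c hcδ hδ (((InfiniteAdeleRing.ringEquiv_mixedSpace F).symm s, b) : AdeleRing (𝓞 F) F) : traceZeroAdele F E c) : AdeleRing (𝓞 E) E).1 w‖₊ ^ 2 :
      ℝ≥0) : ℝ)) = (w δ) ^ 2 * (s.1 ⟨w.comap (algebraMap F E), hw⟩) ^ 2 := by
  rw [NNReal.coe_pow, coe_nnnorm_fst_coe_traceZeroLine]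
  change (‖(InfiniteAdeleRing.ringEquiv_mixedSpace F).symm s (w.comap (algebraMap F E))‖ * w δ) ^ 2 = _
  rw [norm_ringEquiv_mixedSpace_symm_apply _ _ hw, mul_pow, sq_abs, mul_comm]

end Line

/-! ## §4 The CM assembly: `H(ι(w₀)·n(θ(ι⁻¹ s, b))·k) = ((∏_w (1 + (wδ)² s_{w|L⁺}²)) · h_f(b))⁻¹` -/

section CM

variable (L : Type) [Field L] [NumberField L] [IsCMField L]
  (hij : (((0 : Fin 2) : ℕ)) + 1 = ((1 : Fin 2) : ℕ)) (hN : 2 = 2 * ((0 : Fin 2) : ℕ) + 2)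

omit [IsCMField L] in
/-- Every infinite place of the maximal real subfield `L⁺` under a place of `L` is real (`L⁺` is totally real). [folklore] -/
theorem isReal_comap_maximalRealSubfield (w : InfinitePlace L) : (w.comap (algebraMap ↥(maximalRealSubfield L) L)).IsReal :=
  IsTotallyReal.isReal _

/-- **THE HEIGHT ALONG THE BIG-CELL LINE OF `U(1,1)` OVER A CM FIELD, IN CLOSED FORM** (in `ℝ≥0`): for `k ∈ K_U`, `b ∈ 𝔸_{L⁺}^∞`, `s ∈ L⁺ ⊗ ℝ`,
`H(ι(w₀)·n(θ(ι⁻¹ s, b))·k) = ((∏_{w∣∞ of L} (1 + ‖θ(ι⁻¹ s, b)‖₊_w²)) · ∏ᶠ_v max(1, ‖θ(0, b)‖₊_v))⁻¹` (§1, §2 with `L` totally complex, §3 for the finite part).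
[cite: MoeglinWaldspurger1995, I.2.2, II.1.5] [cite: Garrett2018, §2.2] -/
theorem borelHeight_weylLongU_line_mul_eq_cm_two {δ : L} (hcδ : IsCMField.complexConj L δ = -δ) (hδ : δ ≠ 0)
    {k : (quasiSplit (↥(maximalRealSubfield L)) L (IsCMField.complexConj L) 2).Adelic}
    (hk : k ∈ ((standardMaximalCompactGL 2 L).comap (adelicVal ↥(maximalRealSubfield L) L (IsCMField.complexConj L) 2 ((StdForm.antidiagonal 2).over L)) : Subgroup (quasiSplit (↥(maximalRealSubfield L)) L (IsCMField.complexConj L) 2).Adelic))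
    (b : FiniteAdeleRing (𝓞 ↥(maximalRealSubfield L)) ↥(maximalRealSubfield L)) (s : mixedSpace ↥(maximalRealSubfield L)) :
    borelHeight (((quasiSplit (↥(maximalRealSubfield L)) L (IsCMField.complexConj L) 2).toAdelic (weylLongU ((IsCMField.complexConj L : L ≃ₐ[↥(maximalRealSubfield L)] L) : L →+* L) (rfl : ((StdForm.antidiagonal 2).over L) = ((StdForm.antidiagonal 2).over L)))) *
          ((middleRootUnipotent hij hN (Multiplicative.ofAdd (traceZeroLine ↥(maximalRealSubfield L) L (IsCMField.complexConj L) hcδ hδ (((InfiniteAdeleRing.ringEquiv_mixedSpace ↥(maximalRealSubfield L)).symm s, b) : AdeleRing (𝓞 ↥(maximalRealSubfield L)) ↥(maximalRealSubfield L)))) : ↥(adelicUnipotent ↥(maximalRealSubfield L) L (IsCMField.complexConj L) 2)) : (quasiSplit (↥(maximalRealSubfield L)) L (IsCMField.complexConj L) 2).Adelic) * k) =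
      ((∏ w : InfinitePlace L, (1 + ‖((traceZeroLine ↥(maximalRealSubfield L) L (IsCMField.complexConj L) hcδ hδ (((InfiniteAdeleRing.ringEquiv_mixedSpace ↥(maximalRealSubfield L)).symm s, b) : AdeleRing (𝓞 ↥(maximalRealSubfield L)) ↥(maximalRealSubfield L)) : traceZeroAdele ↥(maximalRealSubfield L) L (IsCMField.complexConj L)) : AdeleRing (𝓞 L) L).1 w‖₊ ^ 2)) *
        ∏ᶠ v : HeightOneSpectrum (𝓞 L), max 1 ‖((traceZeroLine ↥(maximalRealSubfield L) L (IsCMField.complexConj L) hcδ hδ ((0, b) : AdeleRing (𝓞 ↥(maximalRealSubfield L)) ↥(maximalRealSubfield L)) : traceZeroAdele ↥(maximalRealSubfield L) L (IsCMField.complexConj L)) : AdeleRing (𝓞 L) L).2 v‖₊)⁻¹ := by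
  haveI : IsTotallyComplex L := IsCMField.isTotallyComplex L
  rw [borelHeight_weylLongU_mul_middleRootUnipotent_mul_two hij hN _ hk, vecHeight_vecCons_one_adele_eq_of_isTotallyComplex]
  rfl

/-- **THE SAME IN `ℝ`, WITH THE ARCHIMEDEAN FACTOR AS ONE-VARIABLE SYMBOLS**: `H(ι(w₀)·n(θ(ι⁻¹ s, b))·k) = ((∏_{w∣∞ of L} (1 + (w δ)²·(s_{w|L⁺})²)) · h_f(b))⁻¹` with
`h_f(b) = ∏ᶠ_v max(1, ‖θ(0,b)‖₊_v) ≥ 1` — the input of ★ (D5-a1) `K2E1OnePlusSqPowerSymbol` (`c_w = (w δ)² > 0`) and ★ (D5-a3 core) `K2E1TensorSymbolProduct`.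
[cite: MoeglinWaldspurger1995, I.2.2, II.1.5] [cite: Garrett2018, §2.2] -/
theorem coe_borelHeight_weylLongU_line_mul_eq_cm_two {δ : L} (hcδ : IsCMField.complexConj L δ = -δ) (hδ : δ ≠ 0)
    {k : (quasiSplit (↥(maximalRealSubfield L)) L (IsCMField.complexConj L) 2).Adelic}
    (hk : k ∈ ((standardMaximalCompactGL 2 L).comap (adelicVal ↥(maximalRealSubfield L) L (IsCMField.complexConj L) 2 ((StdForm.antidiagonal 2).over L)) : Subgroup (quasiSplit (↥(maximalRealSubfield L)) L (IsCMField.complexConj L) 2).Adelic))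
    (b : FiniteAdeleRing (𝓞 ↥(maximalRealSubfield L)) ↥(maximalRealSubfield L)) (s : mixedSpace ↥(maximalRealSubfield L)) :
    (borelHeight (((quasiSplit (↥(maximalRealSubfield L)) L (IsCMField.complexConj L) 2).toAdelic (weylLongU ((IsCMField.complexConj L : L ≃ₐ[↥(maximalRealSubfield L)] L) : L →+* L) (rfl : ((StdForm.antidiagonal 2).over L) = ((StdForm.antidiagonal 2).over L)))) *
          ((middleRootUnipotent hij hN (Multiplicative.ofAdd (traceZeroLine ↥(maximalRealSubfield L) L (IsCMField.complexConj L) hcδ hδ (((InfiniteAdeleRing.ringEquiv_mixedSpace ↥(maximalRealSubfield L)).symm s, b) : AdeleRing (𝓞 ↥(maximalRealSubfield L)) ↥(maximalRealSubfield L)))) : ↥(adelicUnipotent ↥(maximalRealSubfield L) L (IsCMField.complexConj L) 2)) : (quasiSplit (↥(maximalRealSubfield L)) L (IsCMField.complexConj L) 2).Adelic) * k) : ℝ) =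
      ((∏ w : InfinitePlace L, (1 + (w δ) ^ 2 * (s.1 ⟨w.comap (algebraMap ↥(maximalRealSubfield L) L), isReal_comap_maximalRealSubfield L w⟩) ^ 2)) *
        ((∏ᶠ v : HeightOneSpectrum (𝓞 L), max 1 ‖((traceZeroLine ↥(maximalRealSubfield L) L (IsCMField.complexConj L) hcδ hδ ((0, b) : AdeleRing (𝓞 ↥(maximalRealSubfield L)) ↥(maximalRealSubfield L)) : traceZeroAdele ↥(maximalRealSubfield L) L (IsCMField.complexConj L)) : AdeleRing (𝓞 L) L).2 v‖₊ : ℝ≥0) : ℝ))⁻¹ := by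
  rw [borelHeight_weylLongU_line_mul_eq_cm_two L hij hN hcδ hδ hk b s, NNReal.coe_inv, NNReal.coe_mul, NNReal.coe_prod]
  congr 3
  funext w
  rw [NNReal.coe_add, NNReal.coe_one, coe_nnnorm_fst_coe_traceZeroLine_symm_sq hcδ hδ s b w (isReal_comap_maximalRealSubfield L w)]

/-- `1 ≤ h_f(b)`: the finite factor is at least one (so the formula's denominator is positive). [cite: Garrett2018, §2.2] -/
theorem one_le_coe_finprod_line_cm_two {δ : L} (hcδ : IsCMField.complexConj L δ = -δ) (hδ : δ ≠ 0)
    (b : FiniteAdeleRing (𝓞 ↥(maximalRealSubfield L)) ↥(maximalRealSubfield L)) :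
    (1 : ℝ) ≤ ((∏ᶠ v : HeightOneSpectrum (𝓞 L), max 1 ‖((traceZeroLine ↥(maximalRealSubfield L) L (IsCMField.complexConj L) hcδ hδ ((0, b) : AdeleRing (𝓞 ↥(maximalRealSubfield L)) ↥(maximalRealSubfield L)) : traceZeroAdele ↥(maximalRealSubfield L) L (IsCMField.complexConj L)) : AdeleRing (𝓞 L) L).2 v‖₊ : ℝ≥0) : ℝ) := by
  exact_mod_cast one_le_finprod_max_one_nnnorm_snd L _

omit [NumberField L] [IsCMField L] in
/-- `0 < (w δ)²` for `δ ≠ 0`: the symbol constants `c_w` are positive. [folklore] -/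
theorem sq_apply_pos_of_ne_zero {δ : L} (hδ : δ ≠ 0) (w : InfinitePlace L) : 0 < (w δ) ^ 2 :=
  pow_pos (InfinitePlace.pos_iff.2 hδ) 2

end CM

end Summit.HodgeConjecture.HodgeConjecture.Cruxes.H413.K2E1HeightBigCellLineFormulaU2

end
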